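import Literature.Geometry.Symplectic.GromovR4
import Literature.Geometry.Symplectic.GromovR4RelEnd
import Literature.AlgebraicTopology.Homotopy.HomotopyGroupsGeneralPosition
import Literature.Topology.FourManifolds.PuncturedContractibleCompact
import HarnessLib

/-!
# Gromov's punctured-`ℝ⁴` fact from the relative recognition theorem (proofs file)

Sibling proofs file of `Literature/Geometry/Symplectic/GromovR4.lean` (provefact
`Literature.Geometry.Symplectic.gromov_puncturedStandard_diffeomorphic_R4`, route SmoothPoincare4/SymplecticCap).

`gromov_puncturedStandard_diffeomorphic_R4` says: *for a smooth 4-manifold `M`, `p ∈ M` and a 2-form `sf` on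
`V = M ∖ {p}` symplectic and standard near `p` (`IsSymplecticStandardNearPoint p ε sf`), if `V` is
contractible then `V` is diffeomorphic to `ℝ⁴`.* It is the instance, for a punctured manifold, of Gromov's
recognition theorem (Gromov 1985, §0.3.C, Theorem, p. 311: *an open `(V, ω)` symplectically diffeomorphic to
`(ℝ⁴, ω₀)` at infinity — i.e. off compact subsets — with vanishing Hurewicz map `π₂(V) → H₂(V; ℝ)` is
symplectically diffeomorphic to `(ℝ⁴, ω₀)`*; relative form: McDuff–Salamon 2017, Rem. 4.5.2 (viii), vendored
as the named fact `Literature.Geometry.Symplectic.gromov_recognitionR4_relEnd` in `GromovR4RelEnd.lean`, with the proved corollary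
`gromov_recognitionR4_relEnd.chartForm` for COMPACT `M` and `M ∖ {p}` connected with `π₂ = 0`).

The unconditional `gromov_puncturedStandard_diffeomorphic_R4_holds` is NOT claimed: it needs Gromov's
`J`-holomorphic-curve proof (two transversal families of rational `J`-curves as coordinates, Gromov 1985,
2.4.A₁′–2.4.A₂′, and Moser isotopy), none of whose analysis (Fredholm theory, compactness, positivity of
intersections) is formalized. What is proved here is the REDUCTION of the punctured instance to that single
printed theorem:

  `gromov_recognitionR4_relEnd ⟹ gromov_puncturedStandard_diffeomorphic_R4`

(`Literature.Geometry.Symplectic.gromov_puncturedStandard_diffeomorphic_R4_of_relEnd`). The two topological inputs hidden in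
"contractible" are proved:

* `V` contractible ⟹ `V` path connected (Mathlib) and `π₂(V) = 0`
  (`Literature.Geometry.Symplectic.subsingleton_homotopyGroup_of_contractibleSpace`: all `π_N` of a contractible space vanish,
  from the tree's homotopy-invariance lemma `Literature.AlgebraicTopology.Homotopy.subsingleton_homotopyGroup_of_homotopyEquiv`, Hatcher §4.1,
  applied to `V ≃ₕ Unit`);
* `V = M ∖ {p}` contractible ⟹ `M` compact — a genuinely homological fact (Hatcher, Prop. 3.29 with the local
  homology `H₄(M, M ∖ {p}; ℤ) ≅ ℤ` and the long exact sequence of the pair), PROVED over the tree's singular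
  homology layer as `Literature.Topology.FourManifolds.compactSpace_of_contractibleSpace_compl_singleton`
  (`Literature/Topology/FourManifolds/PuncturedContractibleCompact.lean`). It is indispensable: the
  recognition theorem asks the standard end to be the complement of a COMPACT set (`(ℝ⁴ ∖ {0}, ω₀)` is
  connected with `π₂ = 0`, is standard off the closed but NON-compact set `B̄(0, 1) ∖ {0}`, and is not even
  homotopy equivalent to `ℝ⁴`; in the punctured packaging, `M = ℝ⁴`, `p = 0`, `sf = ι*ω₀` satisfies
  `IsSymplecticStandardNearPoint` while `M ∖ {p} ≃ S³`); the complement of the punctured chart-ball in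
  `M ∖ {p}` is `M` minus an open ball, compact iff `M` is.

For compact `M` the conclusion follows from the recognition theorem without homology
(`gromov_recognitionR4_relEnd.nonempty_diffeomorph_of_contractibleSpace`).

## References

* M. Gromov, *Pseudo holomorphic curves in symplectic manifolds*, Invent. Math. 82 (1985) 307–347, §0.3.C
  (Theorem, p. 311) and 2.4.A₂′ (p. 337) [Gromov1985].
* D. McDuff, D. Salamon, *Introduction to Symplectic Topology*, 3rd ed., OUP 2017, Remark 4.5.2 (viii)
  (p. 193 of the held copy) [McDuffSalamon2017]; *J-holomorphic curves and symplectic topology*, 2nd ed.,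
  AMS 2012, §9.4 [McDuffSalamon2012].
* A. Hatcher, *Algebraic Topology*, CUP 2002, §4.1 (homotopy invariance of `πₙ`), Prop. 3.29, §3.3
  [HatcherAT2002].
-/

noncomputable section

open scoped Manifold ContDiff Topology
open TopologicalSpace Set

namespace Literature.Geometry.Symplectic

/-- Local notation for the model space `ℝ⁴ = EuclideanSpace ℝ (Fin 4)`. -/
local notation "E4" => EuclideanSpace ℝ (Fin 4)

/-! ### Homotopy groups of a contractible space vanish -/

/-- All `π_N` of the one-point space are trivial (every `N`-loop is the constant one). [folklore] -/
theorem subsingleton_homotopyGroup_unit (N : Type*) (u : Unit) : Subsingleton (HomotopyGroup N Unit u) := by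
  rw [Literature.AlgebraicTopology.Homotopy.subsingleton_homotopyGroup_iff]
  intro f
  have hf : f = GenLoop.const := GenLoop.ext _ _ fun _ => rfl
  rw [hf]

/-- **All homotopy groups of a contractible space vanish**: `π_N(X, x) = 0` for every finite `N` and every
base point, transported along the homotopy equivalence `X ≃ₕ Unit` (Hatcher, §4.1: homotopy equivalences
induce isomorphisms on all `πₙ`, base points free; `Literature.AlgebraicTopology.Homotopy.subsingleton_homotopyGroup_of_homotopyEquiv`).
[cite: HatcherAT2002, §4.1] -/
theorem subsingleton_homotopyGroup_of_contractibleSpace {N : Type*} [Fintype N] {X : Type*}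
    [TopologicalSpace X] [ContractibleSpace X] (x : X) : Subsingleton (HomotopyGroup N X x) :=
  Literature.AlgebraicTopology.Homotopy.subsingleton_homotopyGroup_of_homotopyEquiv (ContractibleSpace.hequiv_unit X).some
    (fun u => subsingleton_homotopyGroup_unit N u) x

/-! ### The compact case, from the recognition theorem alone -/

variable {M : Type} [TopologicalSpace M] [T2Space M] [SecondCountableTopology M] [ChartedSpace E4 M]
  [IsManifold (𝓡 4) ∞ M]

/-- **Punctured recognition, compact case.** Under the named fact `gromov_recognitionR4_relEnd`
(McDuff–Salamon 2017, Rem. 4.5.2 (viii); Gromov 1985, §0.3.C): for a COMPACT smooth 4-manifold `M`,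
`p ∈ M` and a 2-form `sf` on `M ∖ {p}` symplectic and standard near `p`, if `M ∖ {p}` is contractible then
`M ∖ {p}` is diffeomorphic to `ℝ⁴`. Contractibility supplies the two topological hypotheses of
`gromov_recognitionR4_relEnd.chartForm`: `M ∖ {p}` is path connected and `π₂(M ∖ {p}) = 0`.
[cite: McDuffSalamon2017, Rem. 4.5.2 (viii)] [cite: Gromov1985, §0.3.C] -/
theorem gromov_recognitionR4_relEnd.nonempty_diffeomorph_of_contractibleSpace
    (h : gromov_recognitionR4_relEnd) [CompactSpace M] (p : M) (ε : ℝ)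
    (sf : Literature.Geometry.Kaehler.MForm (𝓡 4) (punctured p) ℝ 2) (hs : IsSymplecticStandardNearPoint p ε sf)
    (hc : ContractibleSpace (punctured p)) : Nonempty ((punctured p) ≃ₘ⟮𝓡 4, 𝓡 4⟯ E4) := by
  haveI : ConnectedSpace (punctured p) := inferInstance
  obtain ⟨Φ, -⟩ := h.chartForm p ε sf hs (fun x => subsingleton_homotopyGroup_of_contractibleSpace x)
  exact ⟨Φ⟩

/-! ### The reduction of the named fact -/

/-- **`gromov_puncturedStandard_diffeomorphic_R4` from the relative recognition theorem alone.** Under the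
named fact `gromov_recognitionR4_relEnd` (Gromov's recognition of `(ℝ⁴, ω₀)` relative at infinity;
McDuff–Salamon 2017, Rem. 4.5.2 (viii), Gromov 1985, §0.3.C), every contractible punctured smooth
4-manifold `M ∖ {p}` carrying a symplectic form standard near `p` is diffeomorphic to `ℝ⁴`: `M` is compact
because `M ∖ {p}` is contractible (`Literature.Topology.FourManifolds.compactSpace_of_contractibleSpace_compl_singleton`, Hatcher
Prop. 3.29 and §3.3, proved), and the compact case applies.
[cite: Gromov1985, §0.3.C] [cite: McDuffSalamon2017, Rem. 4.5.2 (viii)] [cite: HatcherAT2002, Prop. 3.29] -/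
theorem gromov_puncturedStandard_diffeomorphic_R4_of_relEnd (h : gromov_recognitionR4_relEnd) :
    gromov_puncturedStandard_diffeomorphic_R4 := by
  intro M _ _ _ _ _ p ε sf hs hcontr
  haveI : CompactSpace M :=
    Literature.Topology.FourManifolds.compactSpace_of_contractibleSpace_compl_singleton (n := 4) (by norm_num) M p hcontr
  exact h.nonempty_diffeomorph_of_contractibleSpace p ε sf hs hcontr

end Literature.Geometry.Symplectic

end
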